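/-
Copyright (c) 2026 the pub-hodgecm-mathlib formalisation cell (harness21).  Prover seat hodgecm-mathlib-K2E1-p09 (g6), Track B ∕ K2-LIT, h413 =
`stmt-HodgeConjecture-24833`, ENGINE E1, campaign «EIS-R7-BL-SPH-3» (the `N = 3` clone): the `N = 3` twin of ★ `K2E1SphericalEisensteinMeromorphicSuppliersU2` §2b
(K2E3-p12 (g7), p859072) — offered to the successor dealer K2E1-plan (g6) 2026-09-04T09:50Z as the next BL-SPH-3 brick with ★ inputs.
-/
import Summits.HodgeConjecture.HodgeConjecture.Theorems.K2E1SphericalEisensteinMeromorphicSuppliersU2   -- ★ p859072 (K2E3-p12 g7): RANK-GENERIC §1 `exists_heckePackage`, §2a `measure_setOf_lt_ne_top_of_isFiniteMeasure`, `measure_setOf_lt_ne_zero_of_weightedTruncMeasure_ne_zero`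
import Summits.HodgeConjecture.HodgeConjecture.Theorems.K2E1BLIotaClosedEmbeddingU3                -- ★ p858973 (K2E1-p02 g6) P2a-ι₃: `isFiniteMeasure_weightedTruncMeasure_cm_three`
import Summits.HodgeConjecture.HodgeConjecture.Theorems.K2E1BLIotaBoundU3                         -- ★ (K2E1-p02 g6) P2a-ι₃: `exists_pos_forall_mul_lintegral_le_lintegral_comp_pZX_cm_three`
import HarnessLib

/-!
# K2·E1 — `K2E1SphericalEisensteinMeromorphicSuppliersU3` («EIS-R7-BL-SPH-3»): THE CM `N = 3` DISCHARGE OF THE P8 CLOSER'S LETTERS `hfin` (`μZ(Z_c) < ∞`) AND `hne` (`μZ(Z_c) ≠ 0`)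

Track B ∕ K2-LIT, crux h413 = `stmt-HodgeConjecture-24833`, route of record `HCCMUnconditional`; cell `hodgecm-mathlib`, squad K2, ENGINE E1 (campaign «EIS-R7-BL», the BL-SPH-3
clone).  Prover seat `hodgecm-mathlib-K2E1-p09` (g6).  THEOREMS ONLY (no `def`, no `instance`, no notation, no named-fact hypothesis, no `sorry`; default heartbeats); lane
`--supports stmt-HodgeConjecture-24833 --as helper` (count-neutral).  Closes no socket.

★ `K2E1SphericalEisensteinMeromorphicSuppliersU2` (K2E3-p12 (g7)) is RANK-GENERIC in its §1 (the «Hecke package» `exists_heckePackage`) and §2a (the reductions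
`μZ(Z_c) < ∞ ⇐ IsFiniteMeasure (wtm 0 c μZ)`, `μZ(Z_c) ≠ 0 ⇐ wtm k c μZ univ ≠ 0`) — cited by name, not restated; only its §2b is the CM `N = 2` discharge.  THIS FILE is the
`N = 3` twin of §2b on `U(2,1)_{L∕L⁺}`, byte-for-byte with `2 ↦ 3` and the two ι-inputs replaced by their ★ `N = 3` twins (K2E1-p02 (g6), P2a-ι₃):
`isFiniteMeasure_weightedTruncMeasure_cm_three` (★ `K2E1BLIotaClosedEmbeddingU3`) and `exists_pos_forall_mul_lintegral_le_lintegral_comp_pZX_cm_three` (★ `K2E1BLIotaBoundU3`);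
`measurable_supHeight`, `supHeight_pos` are the rank-generic ★ P3-C ones.

* §1 **`measure_setOf_lt_ne_top_cm_three (μ νG hβ hμZ) (hc : 0 < c₀) : μZ {z ∣ c₀ < H_Z z} ≠ ∞`** (letter `hfin` at `N = 3`) and
  **`exists_pos_forall_measure_setOf_lt_ne_zero_cm_three (μ νG hβ hμZ k) : ∃ c₁ > 0, ∀ c₀, 0 < c₀ → c₀ < c₁ → μZ {z ∣ c₀ < H_Z z} ≠ 0`** (letter `hne` at `N = 3`).
HONEST LABEL: HC_CM is proved only modulo the 7 printed citations (2 remaining named inputs: hLiu418 = `stmt-HodgeConjecture-24832`, h413 = `stmt-HodgeConjecture-24833`) until rung 0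
closes; this file asserts no named fact and closes no socket; count-neutral.

## References
* [BernsteinLapid2019] J. Bernstein, E. Lapid, *On the meromorphic continuation of Eisenstein series*, J. Amer. Math. Soc. 37 (2024) (arXiv:1911.02342): §4 Claims 4–5 (p. 10).
* [MoeglinWaldspurger1995] C. Mœglin, J.-L. Waldspurger, *Spectral decomposition and Eisenstein series*, CUP 1995: I.2.13.
-/

set_option autoImplicit false
set_option linter.dupNamespace false  -- the mandated namespace repeats the summit's segment (`HodgeConjecture.HodgeConjecture`)

noncomputable section

open MeasureTheory Filter Topology Set NumberField
open scoped NNReal ENNReal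
open Literature.MeasureTheory.Group Literature.NumberTheory.Automorphic Literature.NumberTheory.Automorphic.UnitaryGroup AdelicGroupData
open Summit.HodgeConjecture.HodgeConjecture.Cruxes.H413.K2E1BLBorelSpacesU2Defs
open Summit.HodgeConjecture.HodgeConjecture.Cruxes.H413.K2E1BLBorelOperatorsU2Defs
open Summit.HodgeConjecture.HodgeConjecture.Cruxes.H413.K2E1BLIotaBoundU3 (exists_pos_forall_mul_lintegral_le_lintegral_comp_pZX_cm_three)
open Summit.HodgeConjecture.HodgeConjecture.Cruxes.H413.K2E1BLIotaClosedEmbeddingU3 (isFiniteMeasure_weightedTruncMeasure_cm_three)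
open Summit.HodgeConjecture.HodgeConjecture.Cruxes.H413.K2E1BLHeckeOperatorHXU2 (supHeight_pos measurable_supHeight)
open Summit.HodgeConjecture.HodgeConjecture.Cruxes.H413.K2E1SphericalEisensteinMeromorphicSuppliersU2 (measure_setOf_lt_ne_top_of_isFiniteMeasure measure_setOf_lt_ne_zero_of_weightedTruncMeasure_ne_zero)

namespace Summit.HodgeConjecture.HodgeConjecture.Cruxes.H413.K2E1SphericalEisensteinMeromorphicSuppliersU3

/-! ## §1 The CM `N = 3` discharge of `hfin`, `hne` -/

section CM

variable (L : Type) [Field L] [NumberField L] [IsCMField L]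
  [MeasurableSpace (quasiSplit (↥(maximalRealSubfield L)) L (IsCMField.complexConj L) 3).Adelic] [BorelSpace (quasiSplit (↥(maximalRealSubfield L)) L (IsCMField.complexConj L) 3).Adelic]

/-- **`μZ(Z_c) < ∞` for the CM datum** (every `c > 0`; ★ `isFiniteMeasure_weightedTruncMeasure_cm_three` at weight `0`) — the letter `hfin`. [cite: BernsteinLapid2019, §4 p. 10] -/
theorem measure_setOf_lt_ne_top_cm_three
    (μ : Measure (quasiSplit (↥(maximalRealSubfield L)) L (IsCMField.complexConj L) 3).automorphicQuotient)
    [(quasiSplit (↥(maximalRealSubfield L)) L (IsCMField.complexConj L) 3).IsAutomorphicMeasure μ]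
    (νG : Measure (quasiSplit (↥(maximalRealSubfield L)) L (IsCMField.complexConj L) 3).Adelic) [νG.IsHaarMeasure] [νG.IsInvInvariant]
    {β : (quasiSplit (↥(maximalRealSubfield L)) L (IsCMField.complexConj L) 3).Adelic → ℝ≥0∞}
    (hβ : IsCoveringWeight ↥((arithmeticBorel (↥(maximalRealSubfield L)) L (IsCMField.complexConj L) 3).map
      (quasiSplit (↥(maximalRealSubfield L)) L (IsCMField.complexConj L) 3).arithmeticSubgroup.subtype) β)
    {μZ : Measure (borelQuotient (↥(maximalRealSubfield L)) L (IsCMField.complexConj L) 3)}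
    (hμZ : ∀ f : borelQuotient (↥(maximalRealSubfield L)) L (IsCMField.complexConj L) 3 → ℝ≥0∞, Measurable f →
      ∫⁻ z, f z ∂μZ = ∫⁻ g, β g * f (toBorelQuotient (↥(maximalRealSubfield L)) L (IsCMField.complexConj L) 3 g) ∂νG) {c₀ : ℝ≥0} (hc : 0 < c₀) :
    μZ {z | c₀ < borelQuotHeight (↥(maximalRealSubfield L)) L (IsCMField.complexConj L) 3 z} ≠ ∞ := by
  haveI := isFiniteMeasure_weightedTruncMeasure_cm_three L μ νG hβ hμZ hc 0
  exact measure_setOf_lt_ne_top_of_isFiniteMeasure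

/-- **`μZ(Z_c) ≠ 0` for the CM datum below the closed-embedding threshold** (★ unfolding lower bound `A·∫⁻ Φ·w₁^{−2k} dμ ≤ ∫⁻ Φ∘p d(wtm)` at `Φ ≡ 1`; `w₁^{−2k} > 0`, `μ` positive on
the non-empty open `univ`) — the letter `hne`. [cite: BernsteinLapid2019, §4 p. 10] -/
theorem exists_pos_forall_measure_setOf_lt_ne_zero_cm_three
    (μ : Measure (quasiSplit (↥(maximalRealSubfield L)) L (IsCMField.complexConj L) 3).automorphicQuotient)
    [(quasiSplit (↥(maximalRealSubfield L)) L (IsCMField.complexConj L) 3).IsAutomorphicMeasure μ]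
    (νG : Measure (quasiSplit (↥(maximalRealSubfield L)) L (IsCMField.complexConj L) 3).Adelic) [νG.IsHaarMeasure] [νG.IsInvInvariant]
    {β : (quasiSplit (↥(maximalRealSubfield L)) L (IsCMField.complexConj L) 3).Adelic → ℝ≥0∞}
    (hβ : IsCoveringWeight ↥((arithmeticBorel (↥(maximalRealSubfield L)) L (IsCMField.complexConj L) 3).map
      (quasiSplit (↥(maximalRealSubfield L)) L (IsCMField.complexConj L) 3).arithmeticSubgroup.subtype) β)
    {μZ : Measure (borelQuotient (↥(maximalRealSubfield L)) L (IsCMField.complexConj L) 3)}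
    (hμZ : ∀ f : borelQuotient (↥(maximalRealSubfield L)) L (IsCMField.complexConj L) 3 → ℝ≥0∞, Measurable f →
      ∫⁻ z, f z ∂μZ = ∫⁻ g, β g * f (toBorelQuotient (↥(maximalRealSubfield L)) L (IsCMField.complexConj L) 3 g) ∂νG) (k : ℕ) :
    ∃ c₁ : ℝ≥0, 0 < c₁ ∧ ∀ c₀ : ℝ≥0, 0 < c₀ → c₀ < c₁ →
      μZ {z | c₀ < borelQuotHeight (↥(maximalRealSubfield L)) L (IsCMField.complexConj L) 3 z} ≠ 0 := by
  obtain ⟨c₁, hc₁, hlow⟩ := exists_pos_forall_mul_lintegral_le_lintegral_comp_pZX_cm_three L μ νG hβ hμZ k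
  refine ⟨c₁, hc₁, fun c₀ hc₀ hc₀₁ => ?_⟩
  obtain ⟨A, hA0, -, hAle⟩ := hlow c₀ hc₀ hc₀₁
  refine measure_setOf_lt_ne_zero_of_weightedTruncMeasure_ne_zero (k := k) ?_
  have hΦ := hAle (fun _ => 1) measurable_const
  simp only [one_mul] at hΦ
  rw [lintegral_const, one_mul] at hΦ
  intro h0
  rw [h0, nonpos_iff_eq_zero, mul_eq_zero] at hΦ
  rcases hΦ with h | h
  · exact hA0 h
  · have hwm : Measurable fun x : (quasiSplit (↥(maximalRealSubfield L)) L (IsCMField.complexConj L) 3).automorphicQuotient =>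
        ((supHeight (↥(maximalRealSubfield L)) L (IsCMField.complexConj L) 3 x)⁻¹ ^ (2 * k) : ℝ≥0) := measurable_supHeight.inv.pow_const _
    rw [lintegral_eq_zero_iff hwm.coe_nnreal_ennreal] at h
    have hfalse : ∀ᵐ x ∂μ, False := by
      filter_upwards [h] with x hx
      rw [Pi.zero_apply, ENNReal.coe_eq_zero] at hx
      exact absurd hx (pow_pos (inv_pos.2 (supHeight_pos x)) _).ne'
    rw [eventually_false_iff_eq_bot, ae_eq_bot] at hfalse
    have hne : (univ : Set (quasiSplit (↥(maximalRealSubfield L)) L (IsCMField.complexConj L) 3).automorphicQuotient).Nonempty :=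
      ⟨(quasiSplit (↥(maximalRealSubfield L)) L (IsCMField.complexConj L) 3).toAutomorphicQuotient 1, mem_univ _⟩
    have hpos := isOpen_univ.measure_ne_zero μ hne
    rw [hfalse] at hpos
    exact hpos rfl

end CM

end Summit.HodgeConjecture.HodgeConjecture.Cruxes.H413.K2E1SphericalEisensteinMeromorphicSuppliersU3

end
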